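import Literature.MathematicalPhysics.QuantumLattice.HubbardRestrictedEtaPairStability
import Literature.MathematicalPhysics.QuantumLattice.PairSourceWindowLocalHamiltonian
import Literature.MathematicalPhysics.QuantumLattice.InfVolFermionStateParticleHole
import Literature.MathematicalPhysics.QuantumLattice.DWaveOrderParameterInfiniteVolume
import HarnessLib

/-!
# No `η`-pairing (staggered on-site pair, `Q = (π,π)`) off-diagonal long-range order in infinite-volume ground
# states of the Hubbard model `Φ(1,0,U) − μn` on `ℤ²` with `2μ < U`

Topic `Literature/MathematicalPhysics/QuantumLattice` (family `hubbard`; cell `hubbard-obs`, seat `hubbard-obs-p1`,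
the "charged ground-state positivity" lever F-C of the cell's TARGET §4 doing what no energy window can do: a ZERO).
Setting: `ω` an infinite-volume ground state (Araki–Moriya / Bratteli–Kishimoto–Robinson, tree `IsGroundState`,
in particular every translation-invariant minimiser of the grand-canonical mean energy `e^{t,U}(ω) − μρ(ω)`,
tree `IsMeanEnergyMinimiser`, BKR Thm. 2) of the nearest-neighbour Hubbard interaction on `ℤ²` at `t = 1`, `t' = 0`,
chemical potential `μ`, no pair source; Yang's `η`-pair operators of a finite region,
`η†_Λ = Σ_{x∈Λ} ε_x c†_{x↑} c†_{x↓}` (`etaRaise`), `η_Λ = (η†_Λ)ᴴ` (`etaLower`), `ε_x = (−1)^{x₁+x₂}` (`siteStagger`).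

* `IsGroundState.re_expect_etaRaise_mul_etaLower_le` — **`2μ < U ⇒ Re ω(η†_Λ η_Λ) ≤ 64 (|Λ'| − |Λ|)²/(U − 2μ)²`**
  for every finite `Λ` and window `Λ' ⊇ thicken Λ 1`: the square of the COLLAR, not of the volume
  (`IsMeanEnergyMinimiser.…` = the same for translation-invariant minimisers of `hubbardTTPrimeMuInteraction 1 0 U μ`);
* `…_halfOpenBox_le` — boxes `Λ_M = [0,M)²`: `Re ω(η†η) ≤ 1024 (M+1)²/(U − 2μ)²`;
* `IsGroundState.tendsto_re_expect_etaRaise_mul_etaLower_div_pow_four` — **`M⁻⁴ Re ω(η†_{Λ_M} η_{Λ_M}) → 0`**: the box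
  pair-LRO functional of Yang's channel VANISHES in every such ground state (it is `O(M⁻²)`), and
  `…_div_sq_le`: the `(π,π)` on-site pair structure factor of boxes stays `≤ 4096/(U − 2μ)²`.

Mechanism (`HubbardRestrictedEtaPairStability.lean`): Bratteli–Robinson local stability `ω(Ã⋆[H_{Λ'}, Ã]) ≥ 0`
(tree `IsGroundState.re_expect_conj_commutator_pairSourceWindowHamiltonianTT'_nonneg`, ALL local `A`, the
grand-canonical `−μN` being inside the Hamiltonian) tested on `A = η_Λ`; Yang's `[H − μN, η†_Λ] = (U − 2μ)η†_Λ − D_∂`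
with `D_∂` the singlet-pair creators on the `≤ 4(|Λ'| − |Λ|)` bonds leaving `Λ`; AM–GM. In words: removing the
`η`-pairs of a box from a ground state would gain `(U − 2μ)·ω(η†η)` in the bulk and can only be paid for by the
boundary, so `ω(η†_Λ η_Λ) = O(|∂Λ|²)`.

WHY THE CELL WANTS IT (hubbard-obs, A0′ = `(U, n, t') = (8, 7/8, 0)`): the certified chemical-potential bracket
(`μ₊(7/8) ≤ 2.5859931 < U/2 = 4`, certificate rows #450/#505/#472) and "every subgradient supports a density-`n`
minimiser" make every translation-invariant torus-limit ground state at density `7/8` a minimiser of `H − μ₊N`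
with `2μ₊ < U`; hence an unconditional EXCLUSION of `η`-pairing ODLRO at the doped anchor (the Summits-side
corollary cites this file). HONEST SCOPE: Yang's staggered `s`-wave channel only — where nobody expects order; says
nothing about `d`-wave pairing or about the uniform on-site channel (crux `NoOnsiteODLRO`); `t' = 0` (bipartite
hopping) and `2μ < U` are load-bearing (at `2μ = U`, half filling, only the finite-torus `ηψ = η†ψ = 0` of
`HubbardHalfFilledPseudospinSinglet.lean` is available); Yang's `η`-paired EIGENSTATES do carry this ODLRO
(`yang_etaPairing_hasODLRO_holds`) — they are not ground states here. Everything PROVED; no definition, no named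
fact, no `sorry`.

## Sources
C. N. Yang, PRL **63** (1989) 2144, eqs. (4)–(8) [cite: Yang1989, eq. (6)]; S.-C. Zhang, PRL **65** (1990) 120
[cite: Zhang1990]; O. Bratteli, D. W. Robinson, *OAQSM 2* (1997) Prop. 5.3.19 [cite: BratteliRobinsonII1997,
Prop. 5.3.19]; O. Bratteli, A. Kishimoto, D. W. Robinson, CMP **64** (1978) 41, Thm. 2
[cite: BratteliKishimotoRobinson1978, Thm. 2]; H. Araki, H. Moriya, Rev. Math. Phys. **15** (2003) 93, §7
[cite: ArakiMoriya2003, §7]; F. H. L. Essler et al., *The One-Dimensional Hubbard Model* (2005) §2.2.5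
[cite: EsslerEtAl2005, §2.2.5 eq. (2.84)]. Nearest prior art in the tree: the finite-torus `η`-vacuum criterion
`HubbardEtaLowestWeightCriterion.lean` (`E₀(N+2) − U < E₀(N) ⇒ ηψ = 0`) and the torus pseudospin ceiling of crux
`NoOnsiteODLRO` (uniform channel); the infinite-volume box statement with a boundary price is in-house.
-/

noncomputable section

namespace Literature.MathematicalPhysics.QuantumLattice

open Matrix Finset HubbardWave0 Filter
open scoped ComplexOrder Topology

/-! ### §2 The `t' = 0`, `h = 0` window Hamiltonian; the staggered sign of `ℤ²` on a window -/

section Window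

open Literature.Probability.LatticeModels

/-- At `t' = 0` the diagonal-hopping interaction has vanishing local Hamiltonians. [cite: XuEtAl2024, eq. (1)] -/
theorem diagHoppingFermionInteraction_zero_localHamiltonian (Λ' : Finset (Site 2)) :
    (diagHoppingFermionInteraction 0).localHamiltonian Λ' = 0 := by
  unfold FermionInteraction.localHamiltonian
  refine Finset.sum_eq_zero fun X _ => ?_
  have h : (diagHoppingFermionInteraction 0).Φ X.1 = 0 := by
    unfold diagHoppingFermionInteraction
    simp
  rw [h, map_zero]

/-- **The sourced `t–t'` window Hamiltonian at `t' = 0`, `h = 0` is the graph Hubbard Hamiltonian of the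
window minus `μ N`**: `H^{src}_{Λ'}(0,U,μ,0) = hamiltonian (polyGraph Λ') 1 U − μ N_{Λ'}`. [cite: KomaTasaki1994, §1] -/
theorem pairSourceWindowHamiltonianTT'_zero_zero (g : Site 2 → ℝ) (Λ' : Finset (Site 2)) (U μ : ℝ) :
    pairSourceWindowHamiltonianTT' g Λ' 0 U μ 0 =
      hamiltonian (polyGraph Λ') 1 U - (μ : ℂ) • (totalNumber : FermionOp Λ') := by
  rw [pairSourceWindowHamiltonianTT', pairSourceWindowHamiltonian, hubbardFermionInteraction_localHamiltonian,
    diagHoppingFermionInteraction_zero_localHamiltonian, add_zero, Complex.ofReal_zero, zero_smul, sub_zero]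

/-- **Nearest neighbours of `ℤ^d` carry opposite staggered signs**, read on the sites of a window:
`x ∼ y` in `polyGraph A` forces `ε_x = −ε_y`, `ε_x = (−1)^{Σ xᵢ}` (`siteStagger`). [cite: LiebPRL1989, proof of Theorem 2] -/
theorem siteStagger_eq_neg_of_polyGraph_adj {d : ℕ} {A : Finset (Site d)} {x y : PolySite A}
    (h : (polyGraph A).Adj x y) : siteStagger (ofLex x.1) = -siteStagger (ofLex y.1) := by
  rw [polyGraph_adj, zdGraph_adj_iff] at h
  obtain ⟨i, h | h⟩ := h
  · rw [h, siteStagger_add_single_one, neg_neg]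
  · rw [h, siteStagger_add_single_one]

variable {Λ Λ' : Finset (Site 2)}

/-- **The embedded restricted `η†`**: `Γ_{Λ ⊆ Λ'}(η†_Λ) = Σ_{w ∈ Λ} ε_w c†_{w↑} c†_{w↓}` inside `𝔄_{Λ'}`, with
Yang's pair creators `etaRaise` of the region `Λ` and the lattice stagger `ε`. [cite: Yang1989, eq. (4)] -/
theorem fermionEmbed_incl_etaRaise (hΛ : Λ ⊆ Λ') :
    fermionEmbed (PolySite.incl hΛ) (etaRaise fun w : PolySite Λ => siteStagger (ofLex w.1)) =
      ∑ w : PolySite Λ, ((siteStagger (ofLex (PolySite.incl hΛ w).1) : ℤ) : ℂ) •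
        (creation (orb (PolySite.incl hΛ w) 0) * creation (orb (PolySite.incl hΛ w) 1)) := by
  rw [etaRaise, fermionEmbed_sum]
  refine sum_congr rfl fun w _ => ?_
  rw [fermionEmbed_smul, map_mul, fermionEmbed_creation, fermionEmbed_creation]
  rfl

/-- `|PolySite A| = |A|`. [folklore] -/
private theorem fintypeCard_polySite_eq_card {d : ℕ} (A : Finset (Site d)) : Fintype.card (PolySite A) = #A := by
  rw [Fintype.card_coe]
  unfold lexSites
  rw [card_map]

/-- In `polyGraph Λ'` every site has at most `4` neighbours among the (embedded) sites of `Λ ⊆ Λ'`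
(`ℤ²` has coordination number `4`). [cite: FriedliVelenik2017, §3.1] -/
theorem card_filter_polyGraph_adj_incl_le_four (hΛ : Λ ⊆ Λ') (x : PolySite Λ') :
    #(univ.filter fun w : PolySite Λ => (polyGraph Λ').Adj x (PolySite.incl hΛ w)) ≤ 4 := by
  have h4 : #((zdGraph 2).neighborFinset (ofLex x.1)) = 4 := card_neighborFinset_zdGraph_holds (ofLex x.1)
  rw [← h4]
  refine Finset.card_le_card_of_injOn (fun w => ofLex (PolySite.incl hΛ w).1) (fun w hw => ?_) ?_
  · rw [Finset.mem_coe, Finset.mem_filter] at hw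
    simp only [Finset.mem_coe, SimpleGraph.mem_neighborFinset]
    exact (polyGraph_adj _ _).1 hw.2
  · intro w _ w' _ hww
    have h1 : (PolySite.incl hΛ w).1 = (PolySite.incl hΛ w').1 := ofLex.injective hww
    exact (PolySite.incl hΛ).injective (Subtype.ext h1)

variable {ω : InfVolFermionState 2} {U μ : ℝ}

/-- **NO `η`-PAIRING LONG-RANGE ORDER BELOW HALF COUPLING — the finite-region inequality.** Let `ω` be an
infinite-volume ground state (Bratteli–Kishimoto–Robinson / Araki–Moriya) of the grand-canonical Hubbard
interaction `Φ(1,0,U) − μn` on `ℤ²` (`t = 1`, `t' = 0`, pair source `h = 0`) with `2μ < U`. For every finite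
region `Λ` and every window `Λ' ⊇ thicken Λ 1`, Yang's `η`-pair operators of the region,
`η†_Λ = Σ_{x∈Λ} (−1)^{x₁+x₂} c†_{x↑}c†_{x↓}` (`etaRaise`), `η_Λ = (η†_Λ)ᴴ` (`etaLower`), obey
`Re ω(η†_Λ η_Λ) ≤ 64 (|Λ'| − |Λ|)² / (U − 2μ)²` — a bound by the SQUARE OF THE COLLAR, not the square of the
volume. Proof: the local-stability inequality `ω(Ã⋆[H_{Λ'}, Ã]) ≥ 0` with `A = η_Λ`, Yang's commutator
`[H − μN, η†_Λ] = (U − 2μ) η†_Λ −` (boundary singlet-pair creators), AM–GM.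
[cite: BratteliRobinsonII1997, Prop. 5.3.19] [cite: Yang1989, eq. (6)] [cite: ArakiMoriya2003, §7] -/
theorem InfVolFermionState.IsGroundState.re_expect_etaRaise_mul_etaLower_le
    (hgs : ω.IsGroundState (hubbardTTPrimeSourcedInteraction 1 0 U μ dWaveFormFactor 0) 1) (hμ : 2 * μ < U)
    (hΛ : Λ ⊆ Λ') (h8 : thicken Λ 1 ⊆ Λ') :
    (ω.expect Λ (etaRaise (fun w : PolySite Λ => siteStagger (ofLex w.1)) *
        etaLower (fun w : PolySite Λ => siteStagger (ofLex w.1)))).re ≤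
      64 * ((#Λ' : ℝ) - #Λ) ^ 2 / (U - 2 * μ) ^ 2 := by
  have hε : ∀ w w' : PolySite Λ, (polyGraph Λ').Adj (PolySite.incl hΛ w) (PolySite.incl hΛ w') →
      siteStagger (ofLex (PolySite.incl hΛ w).1) = -siteStagger (ofLex (PolySite.incl hΛ w').1) :=
    fun w w' h => siteStagger_eq_neg_of_polyGraph_adj h
  have hBR := hgs.re_expect_conj_commutator_pairSourceWindowHamiltonianTT'_nonneg hΛ h8
    (etaLower fun w : PolySite Λ => siteStagger (ofLex w.1))
  rw [pairSourceWindowHamiltonianTT'_zero_zero, etaLower, fermionEmbed_conjTranspose, conjTranspose_conjTranspose,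
    fermionEmbed_incl_etaRaise] at hBR
  have hmain := re_map_restrictedEtaRaise_mul_conjTranspose_le (ω.expect Λ') (ω.expect_nonneg Λ')
    (ω.expect_conjTranspose Λ') (ω.expect_one Λ') (polyGraph Λ') (PolySite.incl hΛ)
    (fun y : PolySite Λ' => siteStagger (ofLex y.1)) hε 4 (card_filter_polyGraph_adj_incl_le_four hΛ) hμ hBR
  have hlhs : ω.expect Λ (etaRaise (fun w : PolySite Λ => siteStagger (ofLex w.1)) *
        etaLower (fun w : PolySite Λ => siteStagger (ofLex w.1))) =
      ω.expect Λ' ((∑ w : PolySite Λ, ((siteStagger (ofLex (PolySite.incl hΛ w).1) : ℤ) : ℂ) •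
          (creation (orb (PolySite.incl hΛ w) 0) * creation (orb (PolySite.incl hΛ w) 1))) *
        (∑ w : PolySite Λ, ((siteStagger (ofLex (PolySite.incl hΛ w).1) : ℤ) : ℂ) •
          (creation (orb (PolySite.incl hΛ w) 0) * creation (orb (PolySite.incl hΛ w) 1)))ᴴ) := by
    rw [← fermionEmbed_incl_etaRaise hΛ, ← fermionEmbed_conjTranspose, ← map_mul, ω.compatible hΛ, etaLower]
  have hcard : (Fintype.card (PolySite Λ') : ℝ) - Fintype.card (PolySite Λ) = (#Λ' : ℝ) - #Λ := by
    rw [fintypeCard_polySite_eq_card, fintypeCard_polySite_eq_card]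
  rw [hlhs]
  refine hmain.trans_eq ?_
  rw [hcard]
  ring

/-- **The same for translation-invariant MINIMISERS of the grand-canonical mean energy `e^{t,U}(ω) − μρ(ω)`**
(Bratteli–Kishimoto–Robinson Thm. 2: minimisers are ground states). [cite: BratteliKishimotoRobinson1978, Thm. 2] -/
theorem InfVolFermionState.IsMeanEnergyMinimiser.re_expect_etaRaise_mul_etaLower_le
    (hmin : ω.IsMeanEnergyMinimiser (hubbardTTPrimeMuInteraction 1 0 U μ) 1) (hμ : 2 * μ < U)
    (hΛ : Λ ⊆ Λ') (h8 : thicken Λ 1 ⊆ Λ') :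
    (ω.expect Λ (etaRaise (fun w : PolySite Λ => siteStagger (ofLex w.1)) *
        etaLower (fun w : PolySite Λ => siteStagger (ofLex w.1)))).re ≤
      64 * ((#Λ' : ℝ) - #Λ) ^ 2 / (U - 2 * μ) ^ 2 := by
  rw [← hubbardTTPrimeSourcedInteraction_zero_source 1 0 U μ dWaveFormFactor] at hmin
  exact hmin.isGroundState_ttPrimeSourced.re_expect_etaRaise_mul_etaLower_le hμ hΛ h8

/-- **Boxes**: for `Λ_M = [0,M)²` (and the window `thicken Λ_M 1`, collar `≤ 4M + 4` sites),
`Re ω(η†_{Λ_M} η_{Λ_M}) ≤ 1024 (M + 1)² / (U − 2μ)²` — quadratic, not quartic, in `M`.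
[cite: BratteliRobinsonII1997, Prop. 5.3.19] [cite: Yang1989, eq. (6)] -/
theorem InfVolFermionState.IsGroundState.re_expect_etaRaise_mul_etaLower_halfOpenBox_le
    (hgs : ω.IsGroundState (hubbardTTPrimeSourcedInteraction 1 0 U μ dWaveFormFactor 0) 1) (hμ : 2 * μ < U)
    (M : ℕ) :
    (ω.expect (halfOpenBox 2 M) (etaRaise (fun w : PolySite (halfOpenBox 2 M) => siteStagger (ofLex w.1)) *
        etaLower (fun w : PolySite (halfOpenBox 2 M) => siteStagger (ofLex w.1)))).re ≤
      1024 * ((M : ℝ) + 1) ^ 2 / (U - 2 * μ) ^ 2 := by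
  have hmain := hgs.re_expect_etaRaise_mul_etaLower_le hμ (subset_thicken (halfOpenBox 2 M) 1)
    (Finset.Subset.refl _)
  have hle : #(halfOpenBox 2 M) ≤ #(thicken (halfOpenBox 2 M) 1) := card_le_card (subset_thicken _ _)
  have h1 := card_thicken_halfOpenBox_sdiff_le (d := 2) M (1 : ℝ)
  rw [Nat.floor_one, Finset.card_sdiff_of_subset (subset_thicken _ _), card_halfOpenBox] at h1
  have h2 : (M + 2 * 1) ^ 2 - M ^ 2 = 4 * M + 4 := by
    rw [show (M + 2 * 1) ^ 2 = M ^ 2 + (4 * M + 4) by ring, Nat.add_sub_cancel_left]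
  rw [h2] at h1
  have hcollar : (#(thicken (halfOpenBox 2 M) 1) : ℝ) - #(halfOpenBox 2 M) ≤ 4 * M + 4 := by
    rw [card_halfOpenBox] at hle ⊢
    have h3 : ((#(thicken (halfOpenBox 2 M) 1) - M ^ 2 : ℕ) : ℝ) ≤ ((4 * M + 4 : ℕ) : ℝ) := by exact_mod_cast h1
    rw [Nat.cast_sub hle] at h3
    push_cast at h3 ⊢
    linarith
  have hcollar0 : (0 : ℝ) ≤ (#(thicken (halfOpenBox 2 M) 1) : ℝ) - #(halfOpenBox 2 M) := by
    have : (#(halfOpenBox 2 M) : ℝ) ≤ #(thicken (halfOpenBox 2 M) 1) := by exact_mod_cast hle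
    linarith
  refine hmain.trans (div_le_div_of_nonneg_right ?_ (sq_nonneg _))
  nlinarith [hcollar, hcollar0]

/-- `0 ≤ Re ω(η†_Λ η_Λ)` (`η†_Λ η_Λ = (η_Λ)ᴴ η_Λ`). [cite: BratteliRobinsonI1987, §2.3.2] -/
theorem InfVolFermionState.re_expect_etaRaise_mul_etaLower_nonneg (ω : InfVolFermionState 2) (Λ : Finset (Site 2))
    (ε : PolySite Λ → ℤˣ) : 0 ≤ (ω.expect Λ (etaRaise ε * etaLower ε)).re := by
  have h := ω.expect_nonneg Λ (etaLower ε)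
  rw [etaLower, conjTranspose_conjTranspose] at h
  exact (Complex.nonneg_iff.1 h).1

/-- **NO `η`-PAIRING OFF-DIAGONAL LONG-RANGE ORDER** (Yang's staggered on-site pair channel, `Q = (π,π)`):
for every infinite-volume ground state of `Φ(1,0,U) − μn` on `ℤ²` with `2μ < U`,
`M⁻⁴ Re ω(η†_{Λ_M} η_{Λ_M}) → 0` as `M → ∞` — the box pair-LRO functional of the channel vanishes (it is `O(M⁻²)`).
Contrast: Yang's `η`-paired eigenstates DO have this ODLRO (`yang_etaPairing_hasODLRO_holds`); they are not
ground states for `2μ < U`. [cite: Yang1989, eqs. (7)–(8)] [cite: BratteliRobinsonII1997, Prop. 5.3.19] -/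
theorem InfVolFermionState.IsGroundState.tendsto_re_expect_etaRaise_mul_etaLower_div_pow_four
    (hgs : ω.IsGroundState (hubbardTTPrimeSourcedInteraction 1 0 U μ dWaveFormFactor 0) 1) (hμ : 2 * μ < U) :
    Filter.Tendsto (fun M : ℕ =>
      (ω.expect (halfOpenBox 2 M) (etaRaise (fun w : PolySite (halfOpenBox 2 M) => siteStagger (ofLex w.1)) *
        etaLower (fun w : PolySite (halfOpenBox 2 M) => siteStagger (ofLex w.1)))).re / (M : ℝ) ^ 4)
      Filter.atTop (nhds 0) := by
  have hc : 0 < U - 2 * μ := by linarith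
  refine tendsto_of_tendsto_of_tendsto_of_le_of_le' tendsto_const_nhds
    (tendsto_const_div_atTop_nhds_zero_nat (4096 / (U - 2 * μ) ^ 2)) ?_ ?_
  · exact Filter.Eventually.of_forall fun M =>
      div_nonneg (ω.re_expect_etaRaise_mul_etaLower_nonneg _ _) (pow_nonneg (Nat.cast_nonneg M) 4)
  · filter_upwards [Filter.eventually_ge_atTop 1] with M hM
    have hM' : (1 : ℝ) ≤ M := by exact_mod_cast hM
    have hb := hgs.re_expect_etaRaise_mul_etaLower_halfOpenBox_le hμ M
    have h4 : (0 : ℝ) < (M : ℝ) ^ 4 := by positivity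
    rw [div_le_div_iff₀ h4 (by positivity)]
    have hc2 : (0 : ℝ) < (U - 2 * μ) ^ 2 := pow_pos hc 2
    have hkey : 1024 * ((M : ℝ) + 1) ^ 2 / (U - 2 * μ) ^ 2 * M ≤ 4096 / (U - 2 * μ) ^ 2 * (M : ℝ) ^ 4 := by
      rw [div_mul_eq_mul_div, div_mul_eq_mul_div, div_le_div_iff₀ hc2 hc2]
      have hA : ((M : ℝ) + 1) ^ 2 ≤ 4 * (M : ℝ) ^ 2 := by nlinarith [hM']
      have hB : ((M : ℝ) + 1) ^ 2 * M ≤ 4 * (M : ℝ) ^ 2 * M := mul_le_mul_of_nonneg_right hA (by positivity)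
      have hC : 4 * (M : ℝ) ^ 2 * M ≤ 4 * (M : ℝ) ^ 4 := by
        have : (M : ℝ) ^ 2 * M * 1 ≤ (M : ℝ) ^ 2 * M * M :=
          mul_le_mul_of_nonneg_left hM' (by positivity)
        nlinarith [this]
      nlinarith [hB, hC, hc2.le]
    have hM0 : (0 : ℝ) ≤ M := by positivity
    calc _ ≤ 1024 * ((M : ℝ) + 1) ^ 2 / (U - 2 * μ) ^ 2 * M := mul_le_mul_of_nonneg_right hb hM0
      _ ≤ _ := hkey

/-- **The `(π,π)` on-site pair structure factor of boxes is bounded**: `M⁻² Re ω(η†_{Λ_M} η_{Λ_M}) ≤ 4096/(U − 2μ)²`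
for `M ≥ 1`. [cite: BratteliRobinsonII1997, Prop. 5.3.19] [cite: Yang1989, eq. (6)] -/
theorem InfVolFermionState.IsGroundState.re_expect_etaRaise_mul_etaLower_div_sq_le
    (hgs : ω.IsGroundState (hubbardTTPrimeSourcedInteraction 1 0 U μ dWaveFormFactor 0) 1) (hμ : 2 * μ < U)
    {M : ℕ} (hM : 1 ≤ M) :
    (ω.expect (halfOpenBox 2 M) (etaRaise (fun w : PolySite (halfOpenBox 2 M) => siteStagger (ofLex w.1)) *
        etaLower (fun w : PolySite (halfOpenBox 2 M) => siteStagger (ofLex w.1)))).re / (M : ℝ) ^ 2 ≤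
      4096 / (U - 2 * μ) ^ 2 := by
  have hc : 0 < U - 2 * μ := by linarith
  have hM' : (1 : ℝ) ≤ M := by exact_mod_cast hM
  have hb := hgs.re_expect_etaRaise_mul_etaLower_halfOpenBox_le hμ M
  rw [div_le_iff₀ (by positivity)]
  refine hb.trans ?_
  rw [div_mul_eq_mul_div, div_le_div_iff₀ (pow_pos hc 2) (pow_pos hc 2)]
  have : ((M : ℝ) + 1) ^ 2 ≤ 4 * (M : ℝ) ^ 2 := by nlinarith [hM']
  nlinarith [this, (pow_pos hc 2).le]

end Window

end Literature.MathematicalPhysics.QuantumLattice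

end
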